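import Summits.QuantumFields.YangMills.Theorems.VirialFluxGapRingStabilizerRigidity
import Summits.QuantumFields.YangMills.Theorems.VirialFluxGapTwistEaterSignClass
import Summits.QuantumFields.YangMills.Theorems.VirialFluxGapRingGaugeAction
import HarnessLib

/-!
# The REFERENCE twist-eater rings `(combFlat w_s; λ·C₀)` are zeros of the twisted ring deficit
# (layer (B), chart-free input, of the DIRECT Laplace road to ⟨stmt-QuantumFields-24204⟩ `VirialFluxGap.SharpTwistedLaplace`)

Helper module (free-hands work of width seat ym-line-sfw-p2-w3 g56, cell ym-idea-1; `--supports 24204`).  For a reference pair `(N₀, C₀)` of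
trace-free elements of `SU(2)` with orthogonal quaternion axes, every twist `z` and every sign class `s`, the wraps
`w_s(k) = centreElem(s_k)·(N₀ if z_k else 1)` commute and satisfy the twist-eater relations `C₀ w_s(k) C₀⁻¹ = centreElem(z_k) w_s(k)`
(★ `reference_twistEater_relations`, ✓`QuantitativeLaplace.twistEater_of_signs` transported along `su2Quat`); hence the reference ring
`R_s = (combFlat w_s on every slice; seam λ·C₀)` is a zero of `F_z` (★ `ringDeficit_reference_eq_zero`, ✓`ringDeficit_combGauge_eq_zero` at `t = 1`).
So the zero set is non-empty (`exists_ringDeficit_eq_zero`, the input `hZ` of ✓`exists_gauge_ringDist_reference_lt_of_sInf_lt`) and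
`f(σ 0) = F_z(R_s) = 0` at the base point of every reference chart.

Everything here is PROVED; no definitions, no named facts (namespace `Summit.QuantumFields.YangMills.Theorems.VirialFluxGap.RingDeficit`).
HONEST FRAMING: algebra; ⟨24204⟩, ⟨24319⟩ and every rung stay OPEN; the Yang–Mills mass gap (Clay) is NOT touched; no summit is proved by a line.

## References
* A. González-Arroyo, C. P. Korthals Altes, Nucl. Phys. B311 (1988) §2 (twist-eating configurations). [GonzalezarroyoAltes1988]
* M. Lüscher, Nucl. Phys. B219 (1983), §2. [Luscher1983]
-/

set_option autoImplicit false

noncomputable section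

open scoped Quaternion Matrix BigOperators
open Literature.MathematicalPhysics.QuantumFieldTheory hiding SU2
open Literature.MathematicalPhysics.QuantumLattice
open Literature.MathematicalPhysics.QuantumFieldTheory.Balaban1983to89.T4WilsonGaugeFlatDirection (su2Quat_injective)
open Literature.MathematicalPhysics.QuantumFieldTheory.Balaban1983to89.T4WilsonLinkAffine (su2Quat_inv)
open Summit.QuantumFields.YangMills.Theorems.FemtoTransferGap
open Summit.QuantumFields.YangMills.Theorems.FemtoTransferGap.TT
open Summit.QuantumFields.YangMills.Theorems.FemtoTransferGap.TwoLattice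
open Summit.QuantumFields.YangMills.Theorems.FemtoTransferGap.TwoLattice.Flat
open Summit.QuantumFields.YangMills.Theorems.FemtoTransferGap.TwoLattice.Cov
open Summit.QuantumFields.YangMills.Theorems.ToronValleyVolume.Lojasiewicz
open Summit.QuantumFields.YangMills.Theorems.TwistEaterVolume.Quadratic
open Summit.QuantumFields.YangMills.Theorems.QuantitativeLaplace

namespace Summit.QuantumFields.YangMills.Theorems.VirialFluxGap.RingDeficit

/-! ## §1 The reference wraps satisfy the twist-eater relations -/

/-- The quaternion of a reference wrap: `q(centreElem b · X) = (±1) • q X`. [folklore] -/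
theorem su2Quat_centreElem_mul (b : Bool) (X : SU2) : su2Quat (centreElem b * X) = (if b then (-1 : ℝ) else 1) • su2Quat X := by
  rw [su2Quat_mul, su2Quat_centreElem_eq_coe, Quaternion.coe_mul_eq_smul]

/-- ★ **The reference wraps are a twist-eater.**  For trace-free `N₀, C₀ ∈ SU(2)` with orthogonal quaternion axes, every twist `z` and sign class
`s`: the wraps `w_s(k) = centreElem(s_k)·(N₀ if z_k else 1)` commute pairwise and `C₀ w_s(k) C₀⁻¹ = centreElem(z_k) w_s(k)`.
[cite: GonzalezarroyoAltes1988, §2] -/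
theorem reference_twistEater_relations {N₀ C₀ : SU2} (hN : (su2Quat N₀).re = 0) (hC : (su2Quat C₀).re = 0)
    (hNC : (su2Quat N₀).imI * (su2Quat C₀).imI + (su2Quat N₀).imJ * (su2Quat C₀).imJ + (su2Quat N₀).imK * (su2Quat C₀).imK = 0)
    (z s : Fin 3 → Bool) :
    (∀ i j, (centreElem (s i) * (if z i then N₀ else 1)) * (centreElem (s j) * (if z j then N₀ else 1)) =
        (centreElem (s j) * (if z j then N₀ else 1)) * (centreElem (s i) * (if z i then N₀ else 1))) ∧
      ∀ k, C₀ * (centreElem (s k) * (if z k then N₀ else 1)) * C₀⁻¹ = centreElem (z k) * (centreElem (s k) * (if z k then N₀ else 1)) := by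
  have hCN : (su2Quat C₀).imI * (su2Quat N₀).imI + (su2Quat C₀).imJ * (su2Quat N₀).imJ + (su2Quat C₀).imK * (su2Quat N₀).imK = 0 := by
    linarith [hNC]
  have hu : ∀ k, su2Quat (centreElem (s k) * (if z k then N₀ else 1)) =
      (if s k then (-1 : ℝ) else 1) • (if z k then su2Quat N₀ else (1 : ℍ)) := fun k => by
    rw [su2Quat_centreElem_mul]
    congr 1
    split_ifs
    · rfl
    · exact su2Quat_one
  obtain ⟨hcomm, htw, hun⟩ := twistEater_of_signs hC hN hCN z (fun k => if s k then (-1 : ℝ) else 1)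
    (fun k => su2Quat (centreElem (s k) * (if z k then N₀ else 1))) hu
  have hstar : su2Quat C₀ * star (su2Quat C₀) = 1 := by
    rw [← su2Quat_inv, ← su2Quat_mul, mul_inv_cancel, su2Quat_one]
  -- abbreviate the wraps
  set W : Fin 3 → SU2 := fun k => centreElem (s k) * (if z k then N₀ else 1) with hW
  have hWk : ∀ k, centreElem (s k) * (if z k then N₀ else 1) = W k := fun k => rfl
  simp only [hWk] at hcomm htw hun ⊢
  refine ⟨fun i j => su2Quat_injective ?_, fun k => su2Quat_injective ?_⟩
  · calc su2Quat (W i * W j) = su2Quat (W i) * su2Quat (W j) := su2Quat_mul _ _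
      _ = su2Quat (W j) * su2Quat (W i) := hcomm i j
      _ = su2Quat (W j * W i) := (su2Quat_mul _ _).symm
  · have eL : su2Quat (C₀ * W k * C₀⁻¹) = su2Quat C₀ * su2Quat (W k) * star (su2Quat C₀) := by
      rw [su2Quat_mul (C₀ * W k) C₀⁻¹, su2Quat_mul C₀ (W k), su2Quat_inv]
    have eR : su2Quat (centreElem (z k) * W k) = su2Quat (centreElem (z k)) * su2Quat (W k) := su2Quat_mul _ _
    rw [eL, eR, su2Quat_centreElem_eq_coe]
    cases hzk : z k
    · have h := hun k hzk
      rw [h, mul_assoc, hstar, mul_one]; simp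
    · have h := htw k hzk
      rw [h, neg_mul, mul_assoc, hstar, mul_one]; simp

/-! ## §2 ★ The reference rings are zeros of the twisted deficit -/

section Ring

variable {L : ℕ} [NeZero L]

/-- ★ **The reference ring `(combFlat w_s; λ·C₀)` is a zero of `F_z`** (✓`ringDeficit_combGauge_eq_zero` at `t = 1`). [cite: Luscher1983, §2] -/
theorem ringDeficit_reference_eq_zero (hL : 2 ≤ L) (z : Fin 3 → Bool)
    {lam : Site 3 L → SU2} (hlamc : ∀ x, lam x ∈ Subgroup.center SU2)
    (hlamflip : ∀ (x : Site 3 L) (k : Fin 3), (x k = 0 ∨ x k = -1) → lam (x.shift k) = lam x * centreElem (z k))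
    (hlamstay : ∀ (x : Site 3 L) (k : Fin 3), x k ≠ 0 → x k ≠ -1 → lam (x.shift k) = lam x)
    {N₀ C₀ : SU2} (hN : (su2Quat N₀).re = 0) (hC : (su2Quat C₀).re = 0)
    (hNC : (su2Quat N₀).imI * (su2Quat C₀).imI + (su2Quat N₀).imJ * (su2Quat C₀).imJ + (su2Quat N₀).imK * (su2Quat C₀).imK = 0)
    (s : Fin 3 → Bool) :
    ringDeficit L z (((fun _ => combFlat (fun k => centreElem (s k) * (if z k then N₀ else 1))), fun x => lam x * C₀) :
      (Fin (2 * L - 1 + 1) → GaugeConfig 3 L SU2) × (Site 3 L → SU2)) = 0 := by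
  haveI : Fact (1 < L) := ⟨hL⟩
  obtain ⟨hww, hcw⟩ := reference_twistEater_relations hN hC hNC z s
  have h := ringDeficit_combGauge_eq_zero hL z hlamc hlamflip hlamstay (fun _ : Site 3 L => (1 : SU2)) hww hcw
  have e1 : (fun _ : Site 3 L => (1 : SU2))⁻¹ = fun _ => (1 : SU2) := by funext x; simp
  rw [e1] at h
  simpa only [gaugeTransform_one, inv_one, one_mul, mul_one] using h

/-- The zero set of `F_z` is non-empty for `L ≥ 2` (the input `hZ` of ✓`exists_gauge_ringDist_reference_lt_of_sInf_lt`; the reference pair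
`N₀ = K = (0,0,0,1)`, `C₀ = I = (0,1,0,0)` pulled back from the quaternions). [folklore] -/
theorem exists_ringDeficit_eq_zero (hL : 2 ≤ L) (z : Fin 3 → Bool) :
    ∃ Q : (Fin (2 * L - 1 + 1) → GaugeConfig 3 L SU2) × (Site 3 L → SU2), ringDeficit L z Q = 0 := by
  obtain ⟨lam, hlamc, _, hflip, hstay⟩ := exists_twistSign hL z
  -- a reference pure orthogonal pair from the quaternion units `K` and `I`
  have hunit : ∀ q : ℍ, Quaternion.normSq q = 1 → ‖q‖ = 1 := fun q hq => by
    have h1 : ‖q‖ * ‖q‖ = 1 := by rw [← Quaternion.normSq_eq_norm_mul_self]; exact hq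
    nlinarith [norm_nonneg q]
  set K : ℍ := ⟨0, 0, 0, 1⟩ with hK
  set I : ℍ := ⟨0, 1, 0, 0⟩ with hI
  have hK1 : ‖K‖ = 1 := hunit K (by rw [hK, Quaternion.normSq_def']; norm_num)
  have hI1 : ‖I‖ = 1 := hunit I (by rw [hI, Quaternion.normSq_def']; norm_num)
  have hK0 : K ≠ 0 := fun h => by rw [h, norm_zero] at hK1; exact zero_ne_one hK1
  have hI0 : I ≠ 0 := fun h => by rw [h, norm_zero] at hI1; exact zero_ne_one hI1
  have hqN : su2Quat (quatToSU2 K) = K := by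
    rw [Balaban1983to89.T4HaarSU2Translate.su2Quat_quatToSU2 hK0, hK1, inv_one, one_smul]
  have hqC : su2Quat (quatToSU2 I) = I := by
    rw [Balaban1983to89.T4HaarSU2Translate.su2Quat_quatToSU2 hI0, hI1, inv_one, one_smul]
  refine ⟨_, ringDeficit_reference_eq_zero hL z hlamc hflip hstay (N₀ := quatToSU2 K) (C₀ := quatToSU2 I)
    (by rw [hqN, hK]) (by rw [hqC, hI]) (by rw [hqN, hqC, hK, hI]; norm_num) (fun _ => false)⟩

end Ring

end Summit.QuantumFields.YangMills.Theorems.VirialFluxGap.RingDeficit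

end
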